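import Literature.Analysis.Calculus.NashMoserSaintRaymond
import HarnessLib

/-!
# Hintz 2026, Thm 13.1 Step 3 and Thm 5.17: the INTERFACE to Saint-Raymond's Nash–Moser theorem, typed
# (index/loss bookkeeping proved; support bookkeeping of the scheme proved; no analysis)

CITATION HEADER (lean-in-tree rule 2026-08-18).  P. Hintz, *Nonlinear stability of subextremal Kerr black
holes*, arXiv:2606.28253 **v2** (2026-08-03), bib key `Hintz2026` — an UNREFEREED CLAIM under adjudication in
this library (`@[claim "Hintz2026" "under-review"]` on `hintz_kerr_stability_subextremal_cauchy`).  TeX line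
numbers `l.N` refer to the v2 source `kerr-stab-r.tex`.  The cited, refereed tool is X. Saint Raymond, *A simple
Nash–Moser implicit function theorem*, Enseign. Math. (2) 35 (1989) 217–226 [SaintRaymond1989], which is
KERNEL-PROVED in `Literature.Analysis.Calculus.NashMoserSaintRaymond` (`SaintRaymond.exists_zero`); this file
is the audit cell `pub-kerr`'s HINTZ-PLAN item R6 / P13: it types WHAT Hintz's Step 3 (l.15160–15183, "We check
the assumptions of the main result of [SR89]", items (1)–(4)) and the proof of Thm 5.17 (l.5258–5278) must hand
to that theorem, and proves the bookkeeping between the printed shapes and Saint-Raymond's hypotheses.  Nothing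
here asserts that Hintz's maps satisfy the estimates; every analytic input is an explicit hypothesis.

WHAT IS TYPED, and what the kernel checks.
* §1 **Degrees of tameness.**  Saint-Raymond's hypotheses use ONE loss `d` throughout ((1): `‖φ(u)‖_s ≤
  C_s(1+|u|_{s+d})` for `s ≥ d`, derivative bounds at `(2d, 3d)`; (3): `|ψ(u)g|_s ≤ C_s(‖g‖_{s+d} +
  |u|_{s+d}‖g‖_{2d})`).  Hintz prints: Thm 12.3 `ThmEfP` (l.14706–14713) `Φ : 𝔇^{k+d} → H_b^{k+2,…} ⊕ 𝔓 ⊕ 𝔔^k`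
  with `P(Φ(U)) ∈ H_b^{k−2,…}` — so the forward map `P∘Ψ` loses `d + 4` orders from `𝔇^{k+d}` to `𝐁^{k−2}`
  relative to the index `k+2` of `Φ(U)`, i.e. as a map of graded scales `𝔇^{s+d+2} → 𝐁^{s}` it has LOSS `d+2`
  (`HintzTame`, the bound form being Step 3 item (2)'s assertion "tame estimates … follow, as usual, from
  Moser-type estimates", l.15174); and Thm 12.8 `ThmEfS` (l.14787–14802) `‖U'‖_k ≤ C_k(‖f‖_{k+d} +
  ‖U‖_{k+d}‖f‖_d)` for all `k ∈ ℕ₀` — LOSS `d`, LOW NORM `‖f‖_d` (`HintzInvTame`; "The same remains true for `Ψ`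
  in place of `Φ`", l.14801).  PROVED: `sr_tame_inv_of_hintz` — Hintz's (3)-shape implies Saint-Raymond's (3) for
  every `d' ≥ d` (the low norm `‖f‖_d ≤ ‖f‖_{2d'}` and the losses are absorbed by the monotone gradations);
  `hypotheses_of_hintzShapes` — with `d_SR := d_H + 2` and `C_s := max(C_s, C'_s)` the printed shapes (and the
  asserted items, carried as hypotheses IN SAINT-RAYMOND'S FORM at `d_SR`) instantiate `SaintRaymond.Hypotheses`
  on Saint-Raymond's ball `|u − u₀|_{3 d_SR} < δ` as soon as that ball lies in Hintz's domain `‖U‖_{𝔇^{d_H}} <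
  ε₀` (`δ ≤ ε₀` suffices: `ball_subset`); `exists_zero_of_hintzShapes` — then `SaintRaymond.exists_zero` yields
  `U ∈ 𝔇^∞` with `P(Ψ(U)) = 0` under the explicit smallness of `‖P(Ψ(0))‖_{2 d_SR}` (Step 3, last paragraph,
  l.15183: "provided `P(Ψ(0))` is sufficiently small in `𝐁^∞` with respect to some fixed high-regularity norm").
* §2 **Thm 5.17** (exterior stability, l.5258–5278): the tame estimate (5.x) `EqEx0Tame` is LITERALLY
  Saint-Raymond's (3) (low norm `‖f‖_{2d}`), "proved (for `d = 11`) in [HintzMink4Gauge, Theorem 3.35]" — at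
  `d = 11` the printed constant is `D = 16·121 + 43·11 + 24 = 2433` (`D_eleven`); with `u₀ = 0` (both uses)
  the dependence of the threshold on `|u₀|_D` is void (`threshold_at_origin`: `|0|_D = 0`, so one may take
  `M = 0` in `SaintRaymond.threshold`).
* §2b **The refereed source of Thm 5.17's estimate**, [Hintz2023] Thm 3.35 / Cor 3.36 (quoted in the §2b
  docstring): losses `(8, 11, 3)` unified into `d = 11` by the source itself — `sr_tame_inv_of_losses` (general loss
  unification for Saint-Raymond's (3)), `hm4g_losses_fit_eleven`, `sr_tame_inv_eleven_of_hm4g`.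
* §3 **Supports along the scheme** (Step 3, last sentence, l.15183: "Since we are using smoothing operators with
  controlled and small increase in supports, the final component `h̃` of `U` automatically has support in
  `𝔱_* ≥ 3/2`"; item (3), l.15177–15179: finite speed of propagation transports the support of `f` to `h̃'`;
  l.15168–15169: `P(Ψ(U)) = 0` for `𝔱_* ≤ c` when `h̃` vanishes for `𝔱_* ≤ c ∈ [3/2, 7/4]`).  This is a
  statement about the STRUCTURE of Saint-Raymond's iteration `u_{k+1} = u_k + S_{θ_k} v_k`,
  `v_k = −ψ(u_k)φ(u_k)` (his Lemma 1), not about the theorem's statement — PROVED abstractly over the tree's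
  `SaintRaymond.seq`: `supported_seq` (by induction, the `k`-th iterate is supported in `𝔱_* ≥ c₀ − Σ_{j<k} η_j`
  from three support hypotheses: `φ` preserves, `ψ(u)` preserves (finite speed), `S_{θ_k}` costs `η_k`).

NOT here (audit work, HINTZ-PLAN T2/T3/T4): that `P∘Ψ` IS `C²` with the bounds (1) at `(2d,3d)`; the Moser-type
tame estimates themselves; the construction of smoothing operators on `𝔇^s` (b-Sobolev, partially polyhomogeneous
and finite-dimensional components: Step 3 item (4), Gluing II Lemma 6.12 / Cor 6.14); Thm 12.8's content.  No
named facts (D-0026): definitions of shapes + theorems only.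

## References
* P. Hintz, arXiv:2606.28253v2 (2026), §13 proof of Thm 13.1 Step 3; §12 Thms 12.3, 12.8; §5.4 Thm 5.17. [Hintz2026]
* X. Saint Raymond, Enseign. Math. (2) 35 (1989) 217–226. [SaintRaymond1989]
* P. Hintz, A. Vasy, Acta Math. 220 (2018), Thm 11.1 and §11.2 (the same interface for Kerr–de Sitter). [HintzVasy2018]
* P. Hintz, Arch. Ration. Mech. Anal. 247 (2023) art. 99 = arXiv:2302.13804, Thm 3.35, Cor 3.36 (the refereed
  source of Thm 5.17's tame estimate; prints `d = 11` and `2433 = 16d²+43d+24`). [Hintz2023]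
-/

noncomputable section

open Finset

namespace Literature.Geometry.Lorentzian

namespace Hintz2026.NashMoserInterface

open Literature.Analysis.Calculus Literature.Analysis.Calculus.SaintRaymond

variable {E : Type*} {F : Type*} [AddCommGroup E]

section Tameness

variable [AddCommGroup F]

/-! ## §1 Degrees of tameness: Hintz's printed shapes ⇒ Saint-Raymond's single-loss hypotheses -/

/-- **Thm 12.3 / Step 3 item (2), shape.**  The forward map (`P∘Ψ`) as a tame map of graded scales with loss
`dH + 2`: `‖P(Ψ(U))‖_s ≤ C_s (1 + ‖U‖_{s + dH + 2})` on the domain `‖U − u₀‖_{dH} < ε₀` (Thm 12.3 prints the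
mapping property `𝔇^{k+d} → 𝐁^{k−2}`, l.14706–14713, on `{‖U‖_{𝔇^d} < ε₀}`; the BOUND is item (2)'s assertion,
l.15174).  A predicate on data; nothing asserted. [cite: Hintz2026, Thm 12.3 (ThmEfP) TeX l.14701-14727 and
proof of Thm 13.1 Step 3 item (2) l.15174 (transcription of shape; claim under review)] -/
def HintzTame (p : ℕ → AddGroupSeminorm E) (q : ℕ → AddGroupSeminorm F) (Φ : E → F) (u₀ : E)
    (dH : ℕ) (ε₀ : ℝ) (C : ℕ → ℝ) : Prop :=
  ∀ u : E, p dH (u - u₀) < ε₀ → ∀ s : ℕ, q s (Φ u) ≤ C s * (1 + p (s + (dH + 2)) u)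

/-- **Thm 12.8, shape** (verbatim indices): for `U` small in `𝔇^d` and every `f`, a solution `U' = ψ(U) f` of the
linearised equation with `‖U'‖_k ≤ C_k (‖f‖_{k+d} + ‖U‖_{k+d} ‖f‖_d)` for all `k ∈ ℕ₀` ("The same remains true
for `Ψ` in place of `Φ`", l.14801).  A predicate on data; nothing asserted. [cite: Hintz2026, Thm 12.8 (ThmEfS)
TeX l.14786-14802 (transcription of shape; claim under review)] -/
def HintzInvTame (p : ℕ → AddGroupSeminorm E) (q : ℕ → AddGroupSeminorm F) (ψ : E → F → E) (u₀ : E)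
    (dH : ℕ) (ε₀ : ℝ) (Ck : ℕ → ℝ) : Prop :=
  ∀ u : E, p dH (u - u₀) < ε₀ → ∀ f : F, ∀ k : ℕ,
    p k (ψ u f) ≤ Ck k * (q (k + dH) f + p (k + dH) u * q dH f)

/-- Saint-Raymond's ball `|u − u₀|_{3d'} < δ` lies in Hintz's domain `‖U − u₀‖_{dH} < ε₀` as soon as
`dH ≤ 3d'` and `δ ≤ ε₀` (monotone gradation). [cite: SaintRaymond1989, Theorem p.219 (the ball of (1));
Hintz2026, Thm 12.3 l.14704 (the domain of Φ)] -/
theorem ball_subset {p : ℕ → AddGroupSeminorm E} (hmono : ∀ s t : ℕ, s ≤ t → ∀ v : E, p s v ≤ p t v)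
    {u₀ u : E} {dH d' : ℕ} (hd : dH ≤ 3 * d') {δ ε₀ : ℝ} (hδ : δ ≤ ε₀)
    (hu : p (3 * d') (u - u₀) < δ) : p dH (u - u₀) < ε₀ :=
  lt_of_le_of_lt (hmono dH (3 * d') hd _) (lt_of_lt_of_le hu hδ)

/-- **Hintz's Thm 12.8 shape implies Saint-Raymond's (3)** for every `d' ≥ dH` (and hence for `d' = dH + 2`):
the low norm `‖f‖_{dH} ≤ ‖f‖_{2d'}` and the loss `dH ≤ d'` are absorbed by the monotone gradations.  Pure
bookkeeping. [cite: SaintRaymond1989, (3) p.220; Hintz2026, Thm 12.8 l.14795-14800] -/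
theorem sr_tame_inv_of_hintz {p : ℕ → AddGroupSeminorm E} {q : ℕ → AddGroupSeminorm F} {ψ : E → F → E}
    {u₀ : E} {dH : ℕ} {ε₀ : ℝ} {Ck : ℕ → ℝ} (h : HintzInvTame p q ψ u₀ dH ε₀ Ck)
    (hp : ∀ s t : ℕ, s ≤ t → ∀ v : E, p s v ≤ p t v) (hq : ∀ s t : ℕ, s ≤ t → ∀ w : F, q s w ≤ q t w)
    (hCk : ∀ k, 0 ≤ Ck k) {d' : ℕ} (hd : dH ≤ d') :
    ∀ u : E, p dH (u - u₀) < ε₀ → ∀ s : ℕ, ∀ f : F,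
      p s (ψ u f) ≤ Ck s * (q (s + d') f + p (s + d') u * q (2 * d') f) := by
  intro u hu s f
  have h1 := h u hu f s
  have h2 : q (s + dH) f ≤ q (s + d') f := hq _ _ (by omega) _
  have h3 : p (s + dH) u ≤ p (s + d') u := hp _ _ (by omega) _
  have h4 : q dH f ≤ q (2 * d') f := hq _ _ (by omega) _
  have h5 : p (s + dH) u * q dH f ≤ p (s + d') u * q (2 * d') f :=
    mul_le_mul h3 h4 (apply_nonneg _ _) (apply_nonneg _ _)
  exact h1.trans (mul_le_mul_of_nonneg_left (add_le_add h2 h5) (hCk s))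

/-- **The dictionary.**  With `d_SR := dH + 2` and `C_s := max(C_s, C'_s)`, Hintz's printed shapes `HintzTame`
(Thm 12.3 + item (2)) and `HintzInvTame` (Thm 12.8 + item (3), together with a right inverse `ψ`), the asserted
items carried as hypotheses in Saint-Raymond's own form at `d_SR` (item (1): the `C²` bounds at `(2d_SR, 3d_SR)` and
their integrated forms; item (4): the smoothing operators (4) on the `𝔇`-scale), instantiate
`SaintRaymond.Hypotheses` at loss `d_SR`, provided Saint-Raymond's ball lies in Hintz's domain (`δ ≤ ε₀`).
Bookkeeping only: every analytic input is an explicit hypothesis. [cite: Hintz2026, proof of Thm 13.1 Step 3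
items (1)-(4), TeX l.15171-15181; SaintRaymond1989, Theorem and Remark pp.219-220] -/
theorem hypotheses_of_hintzShapes {p : ℕ → AddGroupSeminorm E} {q : ℕ → AddGroupSeminorm F}
    {S : ℝ → E → E} {φ : E → F} {φ' : E → E →+ F} {ψ : E → F → E} {u₀ : E} {dH : ℕ}
    {ε₀ δ C₁ C₂ : ℝ} {C Ck : ℕ → ℝ} {Csm : ℕ → ℕ → ℝ}
    (hδ : 0 < δ) (hδε : δ ≤ ε₀) (hC₁ : 0 ≤ C₁) (hC₂ : 0 ≤ C₂) (hC : ∀ s, 0 ≤ C s) (hCk : ∀ s, 0 ≤ Ck s)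
    (hCsm : ∀ s t, 0 ≤ Csm s t)
    (hp : ∀ s t : ℕ, s ≤ t → ∀ v : E, p s v ≤ p t v) (hq : ∀ s t : ℕ, s ≤ t → ∀ w : F, q s w ≤ q t w)
    -- item (4): smoothing operators on the `𝔇`-scale, Saint-Raymond's (4)
    (smooth_le : ∀ θ : ℝ, 1 < θ → ∀ s t : ℕ, t ≤ s → ∀ v : E,
      p s (S θ v) ≤ Csm s t * θ ^ ((s : ℝ) - t) * p t v)
    (sub_smooth_le : ∀ θ : ℝ, 1 < θ → ∀ s t : ℕ, s ≤ t → ∀ v : E,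
      p s (v - S θ v) ≤ Csm s t * θ ^ ((s : ℝ) - t) * p t v)
    -- Thm 12.3 + item (2): the forward tame shape with loss `dH + 2`
    (htame : HintzTame p q φ u₀ dH ε₀ C)
    -- item (1): `C²` with the bounds of (1) at `(2 d_SR, 3 d_SR)`, `d_SR = dH + 2`, and their integrated forms
    (deriv_le : ∀ u : E, p dH (u - u₀) < ε₀ → ∀ v : E,
      q (2 * (dH + 2)) (φ' u v) ≤ C₁ * p (3 * (dH + 2)) v)
    (lipschitz : ∀ u u' : E, p dH (u - u₀) < ε₀ → p dH (u' - u₀) < ε₀ →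
      q (2 * (dH + 2)) (φ u' - φ u) ≤ C₁ * p (3 * (dH + 2)) (u' - u))
    (taylor : ∀ u u' : E, p dH (u - u₀) < ε₀ → p dH (u' - u₀) < ε₀ →
      q (2 * (dH + 2)) (φ u' - φ u - φ' u (u' - u)) ≤ C₂ * p (3 * (dH + 2)) (u' - u) ^ 2)
    -- Thm 12.8 + item (3): right inverse with Hintz's tame shape
    (right_inv : ∀ u : E, p dH (u - u₀) < ε₀ → ∀ g : F, φ' u (ψ u g) = g)
    (hinv : HintzInvTame p q ψ u₀ dH ε₀ Ck) :
    SaintRaymond.Hypotheses p q S φ φ' ψ u₀ (dH + 2) δ C₁ C₂ (fun s => max (C s) (Ck s)) Csm := by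
  have hball : ∀ u : E, p (3 * (dH + 2)) (u - u₀) < δ → p dH (u - u₀) < ε₀ :=
    fun u hu => ball_subset hp (by omega) hδε hu
  refine
    { d_pos := by omega
      δ_pos := hδ
      C₁_nonneg := hC₁
      C₂_nonneg := hC₂
      C_nonneg := fun s => (hC s).trans (le_max_left _ _)
      Csm_nonneg := hCsm
      p_mono := hp
      q_mono := hq
      smooth_le := smooth_le
      sub_smooth_le := sub_smooth_le
      tame := ?_
      deriv_le := fun u hu v => deriv_le u (hball u hu) v
      lipschitz := fun u u' hu hu' => lipschitz u u' (hball u hu) (hball u' hu')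
      taylor := fun u u' hu hu' => taylor u u' (hball u hu) (hball u' hu')
      right_inv := fun u hu g => right_inv u (hball u hu) g
      tame_inv := ?_ }
  · intro u hu s _
    have h1 := htame u (hball u hu) s
    have hpos : 0 ≤ 1 + p (s + (dH + 2)) u := by linarith [apply_nonneg (p (s + (dH + 2))) u]
    exact h1.trans (mul_le_mul_of_nonneg_right (le_max_left _ _) hpos)
  · intro u hu s _ g
    have h1 := sr_tame_inv_of_hintz hinv hp hq hCk (d' := dH + 2) (by omega) u (hball u hu) s g
    have hpos : 0 ≤ q (s + (dH + 2)) g + p (s + (dH + 2)) u * q (2 * (dH + 2)) g := by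
      have := apply_nonneg (q (s + (dH + 2))) g
      have := mul_nonneg (apply_nonneg (p (s + (dH + 2))) u) (apply_nonneg (q (2 * (dH + 2))) g)
      linarith
    exact h1.trans (mul_le_mul_of_nonneg_right (le_max_right _ _) hpos)

/-- **Step 3's conclusion from the dictionary and the tree's Saint-Raymond theorem**: under the hypotheses of
`hypotheses_of_hintzShapes`, sequential completeness of the `𝔇`-scale and definiteness of `‖·‖_{2 d_SR}`, and the
EXPLICIT smallness `‖P(Ψ(u₀))‖_{2 d_SR} ≤ SaintRaymond.threshold (dH+2) δ M C₁ C₂ (max C C') Csm` (Step 3, last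
paragraph, l.15183), there is `U` in Saint-Raymond's ball with `P(Ψ(U)) = 0`.  (In Hintz's use `u₀ = 0`.)
[cite: Hintz2026, proof of Thm 13.1 Step 3, TeX l.15171-15183; SaintRaymond1989, Theorem p.220] -/
theorem exists_zero_of_hintzShapes {p : ℕ → AddGroupSeminorm E} {q : ℕ → AddGroupSeminorm F}
    {S : ℝ → E → E} {φ : E → F} {φ' : E → E →+ F} {ψ : E → F → E} {u₀ : E} {dH : ℕ}
    {δ C₁ C₂ : ℝ} {C Ck : ℕ → ℝ} {Csm : ℕ → ℕ → ℝ}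
    (H : SaintRaymond.Hypotheses p q S φ φ' ψ u₀ (dH + 2) δ C₁ C₂ (fun s => max (C s) (Ck s)) Csm)
    (hE : SaintRaymond.IsComplete p) (hq : ∀ w : F, q (2 * (dH + 2)) w = 0 → w = 0) {M : ℝ}
    (hM : p (SaintRaymond.D (dH + 2)) u₀ ≤ M)
    (hsmall : q (2 * (dH + 2)) (φ u₀) ≤
      SaintRaymond.threshold (dH + 2) δ M C₁ C₂ (fun s => max (C s) (Ck s)) Csm) :
    ∃ u : E, p (3 * (dH + 2)) (u - u₀) < δ ∧ φ u = 0 :=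
  SaintRaymond.exists_zero H hE hq hM hsmall

/-! ## §2 Thm 5.17: the printed loss `d = 11` -/

/-- For Thm 5.17 the tame estimate (5.x) `EqEx0Tame` (l.5268–5275) has Saint-Raymond's shape (3) with `d = 11`
("proved (for `d = 11`) in [HintzMink4Gauge, Theorem 3.35]", l.5276); the printed constant of the theorem is then
`D = 16·11² + 43·11 + 24 = 2433` derivatives. [cite: Hintz2026, proof of Thm 5.17 TeX l.5258-5278;
SaintRaymond1989, Theorem p.220] -/
theorem D_eleven : SaintRaymond.D 11 = 2433 := by
  rw [SaintRaymond.D_eq]; norm_num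

/-- `N = 92` and `T = 2411` at `d = 11`. [cite: SaintRaymond1989, p.221] -/
theorem N_T_eleven : SaintRaymond.N 11 = 92 ∧ SaintRaymond.T 11 = 2411 := by
  rw [SaintRaymond.N_eq, SaintRaymond.T_eq]; omega

/-- In both of Hintz's uses `u₀ = 0` (Step 3: "`Φ(0) = (0,0,0)`", l.15165; Thm 5.17: perturbation `h` of
`g_{b₀}`), so `|u₀|_D = 0` and the printed dependence of the smallness on `|u₀|_D` is void: one may take `M = 0`,
and Saint-Raymond's threshold is then a function of `d, δ, C₁, C₂, (C_s), (C_{s,t})` alone.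
[cite: SaintRaymond1989, Theorem p.220; Hintz2026, l.15165] -/
theorem threshold_at_origin {p : ℕ → AddGroupSeminorm E} (d : ℕ) :
    p (SaintRaymond.D d) (0 : E) ≤ 0 := by
  rw [map_zero]

/-! ## §2b The refereed source behind Thm 5.17's tame estimate: [Hintz2023] Thm 3.35 / Cor 3.36

Hintz 2026 (l.5276–5278) proves Thm 5.17 by "the Nash–Moser iteration scheme [SR89]" after the tame estimate
(5.x) `EqEx0Tame`, "proved (for `d = 11`) in [HintzMink4Gauge, Theorem 3.35]", the proof being "the same (with
minor, only notational, modifications) as that of [HintzMink4Gauge, Corollary 3.36]" (l.5266).  The REFEREED source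
(P. Hintz, *Exterior stability of Minkowski space in generalized harmonic gauge*, Arch. Ration. Mech. Anal. 247
(2023) no. 5, art. 99 = arXiv:2302.13804, bib `Hintz2023`; TeX `mink4-gauge.tex` of the e-print) prints:
Thm 3.35 (`ThmNY`, TeX l.2288–2300): "Let `k, m ∈ ℕ₀` with `k ≥ m+11`. Let `g = g_𝔪 + r^{-1}h ∈ 𝒢^{k,(ℓ₀,ℓ_𝒥)}`,
with `h` small in `𝒢̃^{8,(ℓ₀,ℓ_𝒥)}`. Consider `f ∈ ℱ^{m+8,(ℓ₀,ℓ_𝒥)}` … which vanishes near `Σ`. Then the unique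
forward solution `u` of `L_g u = f` satisfies `u ∈ 𝒢̃^{m,(ℓ₀,ℓ_𝒥)}` and a tame estimate
`‖u‖_{𝒢̃^m} ≤ C(‖f‖_{ℱ^{m+8}} + ‖h‖_{𝒢̃^{m+11}} ‖f‖_{ℱ^3})`" — i.e. losses `8` on `f`, `11` on the
coefficient `h`, low norm index `3`; and Cor 3.36 (`CorNYStab`, l.2358–2384): "assume that `(h₀,h₁)` is small in
the sense that `‖(h₀,h₁)‖_{22} < C` where `C = C(‖(h₀,h₁)‖_{2433})` … applying the main theorem of [SR89] with
loss of derivatives parameter `d = 11` (cf. (3.35's estimate)) …; here, `2433 = 16d² + 43d + 24`."  So the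
refereed source itself unifies the losses `(8, 11, 3)` into Saint-Raymond's single `d = 11` (possible because
`8 ≤ 11`, `11 ≤ 11`, `3 ≤ 22` and the scales are monotone — `sr_tame_inv_of_losses` below) and prints the two
numbers `22 = 2d` and `2433 = D` that `SaintRaymond.D_eq`/`D_eleven` compute. -/

/-- **Loss unification for Saint-Raymond's (3)**: a tame right-inverse estimate with loss `a` on the datum `f`,
loss `b` on the coefficient `u` and low norm index `c`, `|ψ(u)f|_s ≤ C_s(‖f‖_{s+a} + |u|_{s+b}‖f‖_c)`, implies
Saint-Raymond's form (3) for EVERY `d ≥ max(a, b)` with `2d ≥ c` (monotone gradations).  Pure bookkeeping; covers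
[Hintz2023] Thm 3.35 (`a = 8`, `b = 11`, `c = 3` ⇒ `d = 11`) and Hintz 2026 Thm 12.8 (`a = b = c = d_H`).
[cite: SaintRaymond1989, (3) p.220; Hintz2023, Thm 3.35 and Cor 3.36] -/
theorem sr_tame_inv_of_losses {p : ℕ → AddGroupSeminorm E} {q : ℕ → AddGroupSeminorm F} {ψ : E → F → E}
    {ball : E → Prop} {a b c : ℕ} {Cs : ℕ → ℝ}
    (h : ∀ u : E, ball u → ∀ f : F, ∀ s : ℕ, p s (ψ u f) ≤ Cs s * (q (s + a) f + p (s + b) u * q c f))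
    (hp : ∀ s t : ℕ, s ≤ t → ∀ v : E, p s v ≤ p t v) (hq : ∀ s t : ℕ, s ≤ t → ∀ w : F, q s w ≤ q t w)
    (hCs : ∀ s, 0 ≤ Cs s) {d : ℕ} (ha : a ≤ d) (hb : b ≤ d) (hc : c ≤ 2 * d) :
    ∀ u : E, ball u → ∀ s : ℕ, ∀ f : F,
      p s (ψ u f) ≤ Cs s * (q (s + d) f + p (s + d) u * q (2 * d) f) := by
  intro u hu s f
  have h1 := h u hu f s
  have h2 : q (s + a) f ≤ q (s + d) f := hq _ _ (by omega) _
  have h3 : p (s + b) u ≤ p (s + d) u := hp _ _ (by omega) _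
  have h4 : q c f ≤ q (2 * d) f := hq _ _ hc _
  have h5 : p (s + b) u * q c f ≤ p (s + d) u * q (2 * d) f :=
    mul_le_mul h3 h4 (apply_nonneg _ _) (apply_nonneg _ _)
  exact h1.trans (mul_le_mul_of_nonneg_left (add_le_add h2 h5) (hCs s))

/-- The printed losses of [Hintz2023] Thm 3.35 fit Saint-Raymond's `d = 11`: `8 ≤ 11`, `11 ≤ 11`, `3 ≤ 22`; the
two numbers printed in [Hintz2023] Cor 3.36 are `2d = 22` and `D = 2433`.
[cite: Hintz2023, Thm 3.35 (TeX l.2288-2300) and Cor 3.36 (l.2358-2384); SaintRaymond1989, Theorem p.220] -/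
theorem hm4g_losses_fit_eleven :
    (8 : ℕ) ≤ 11 ∧ (11 : ℕ) ≤ 11 ∧ (3 : ℕ) ≤ 2 * 11 ∧ 2 * 11 = 22 ∧ SaintRaymond.D 11 = 2433 :=
  ⟨by norm_num, le_rfl, by norm_num, rfl, D_eleven⟩

/-- **[Hintz2023] Thm 3.35's shape ⇒ Saint-Raymond's (3) with `d = 11`**, the form (5.x) `EqEx0Tame` in which
Hintz 2026 quotes it (l.5268–5275: `‖ġ‖_k ≤ C_k(‖f‖_{k+d} + ‖h‖_{k+d}‖f‖_{2d})`, "for `d = 11`").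
[cite: Hintz2023, Thm 3.35; Hintz2026, proof of Thm 5.17 eq. (EqEx0Tame) TeX l.5268-5278] -/
theorem sr_tame_inv_eleven_of_hm4g {p : ℕ → AddGroupSeminorm E} {q : ℕ → AddGroupSeminorm F}
    {ψ : E → F → E} {ball : E → Prop} {Cs : ℕ → ℝ}
    (h : ∀ u : E, ball u → ∀ f : F, ∀ s : ℕ, p s (ψ u f) ≤ Cs s * (q (s + 8) f + p (s + 11) u * q 3 f))
    (hp : ∀ s t : ℕ, s ≤ t → ∀ v : E, p s v ≤ p t v) (hq : ∀ s t : ℕ, s ≤ t → ∀ w : F, q s w ≤ q t w)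
    (hCs : ∀ s, 0 ≤ Cs s) :
    ∀ u : E, ball u → ∀ s : ℕ, ∀ f : F,
      p s (ψ u f) ≤ Cs s * (q (s + 11) f + p (s + 11) u * q (2 * 11) f) :=
  sr_tame_inv_of_losses h hp hq hCs (by norm_num) le_rfl (by norm_num)

end Tameness

/-! ## §3 Supports along the Moser–Nash scheme (Step 3, last sentence) -/

section Support

variable (S : ℝ → E → E) (φ : E → F) (ψ : E → F → E) (u₀ : E) (θ₀ : ℝ)

/-- **Support bookkeeping of the scheme** `u_{k+1} = u_k + S_{θ_k} v_k`, `v_k = −ψ(u_k)φ(u_k)` (Saint-Raymond's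
Lemma 1), abstractly: `SuppE c x` = "the `h̃`-component of `x` is supported in `𝔱_* ≥ c`", `SuppF c y` = "`y`
is supported in `𝔱_* ≥ c`".  Hypotheses = the three printed support facts: `hφ` — `P(Ψ(U))` is supported in
`{𝔱_* ≥ c}` when `h̃` is (l.15168–15169; for `c` in the admissible window); `hψ` — the solution operator of item
(3) transports the support of `f` to `h̃'` by finite speed of propagation (l.15177–15179); `hS` — the smoothing
operator `S_{θ_k}` enlarges supports by at most `η_k` (l.15180–15181, "increase supports by very small amounts
(which sum to any small number, say `1/4`, over the entire iteration scheme)").  Conclusion, PROVED by induction: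
the `k`-th iterate is supported in `𝔱_* ≥ c₀ − Σ_{j<k} η_j` as long as this stays in the window.  This is a
property of the SCHEME (the proof of [SR89]), not of its statement — exactly as used at l.15183.
[cite: Hintz2026, proof of Thm 13.1 Step 3, TeX l.15168-15183; SaintRaymond1989, Lemma 1 p.220] -/
theorem supported_seq (SuppE : ℝ → E → Prop) (SuppF : ℝ → F → Prop) (c₁ c₀ : ℝ) (η : ℕ → ℝ)
    (hη : ∀ k, 0 ≤ η k)
    (anti : ∀ c c' : ℝ, c' ≤ c → ∀ x : E, SuppE c x → SuppE c' x)
    (add : ∀ c : ℝ, ∀ x y : E, SuppE c x → SuppE c y → SuppE c (x + y))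
    (neg : ∀ c : ℝ, ∀ x : E, SuppE c x → SuppE c (-x))
    (hφ : ∀ c : ℝ, c₁ ≤ c → c ≤ c₀ → ∀ u : E, SuppE c u → SuppF c (φ u))
    (hψ : ∀ c : ℝ, c₁ ≤ c → c ≤ c₀ → ∀ u : E, ∀ f : F, SuppF c f → SuppE c (ψ u f))
    (hS : ∀ k : ℕ, ∀ c : ℝ, ∀ x : E, SuppE c x → SuppE (c - η k) (S (SaintRaymond.theta θ₀ k) x))
    (h0 : SuppE c₀ u₀) :
    ∀ k : ℕ, c₁ ≤ c₀ - ∑ j ∈ range k, η j →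
      SuppE (c₀ - ∑ j ∈ range k, η j) (SaintRaymond.seq S φ ψ u₀ θ₀ k) := by
  intro k
  induction k with
  | zero => intro _; simpa using h0
  | succ k ih =>
    intro hk
    have hsum : ∑ j ∈ range (k + 1), η j = ∑ j ∈ range k, η j + η k := sum_range_succ _ _
    have hle : c₀ - ∑ j ∈ range (k + 1), η j ≤ c₀ - ∑ j ∈ range k, η j := by rw [hsum]; linarith [hη k]
    have hk' : c₁ ≤ c₀ - ∑ j ∈ range k, η j := hk.trans hle
    have hc0 : c₀ - ∑ j ∈ range k, η j ≤ c₀ := by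
      linarith [sum_nonneg (fun j (_ : j ∈ range k) => hη j)]
    have hu := ih hk'
    set c : ℝ := c₀ - ∑ j ∈ range k, η j with hc
    have hv : SuppE c (-(ψ (SaintRaymond.seq S φ ψ u₀ θ₀ k) (φ (SaintRaymond.seq S φ ψ u₀ θ₀ k)))) :=
      neg _ _ (hψ c hk' hc0 _ _ (hφ c hk' hc0 _ hu))
    have hSv := hS k c _ hv
    rw [SaintRaymond.seq_succ, SaintRaymond.incr]
    rw [show c₀ - ∑ j ∈ range (k + 1), η j = c - η k by rw [hsum, hc]; ring]
    exact add _ _ _ (anti c (c - η k) (by linarith [hη k]) _ hu) hSv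

/-- The printed instance: `c₀ = 7/4` (`χ₋ = 1` on `(−∞, 7/4]`, l.15160), window down to `c₁ = 3/2`, total support
cost `Σ η_j ≤ 1/4` ⇒ every iterate is supported in `𝔱_* ≥ 3/2`. [cite: Hintz2026, proof of Thm 13.1 Step 3,
TeX l.15160, l.15181-15183] -/
theorem supported_seq_three_halves (SuppE : ℝ → E → Prop) (SuppF : ℝ → F → Prop) (η : ℕ → ℝ)
    (hη : ∀ k, 0 ≤ η k) (hsum : ∀ k, ∑ j ∈ range k, η j ≤ 1 / 4)
    (anti : ∀ c c' : ℝ, c' ≤ c → ∀ x : E, SuppE c x → SuppE c' x)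
    (add : ∀ c : ℝ, ∀ x y : E, SuppE c x → SuppE c y → SuppE c (x + y))
    (neg : ∀ c : ℝ, ∀ x : E, SuppE c x → SuppE c (-x))
    (hφ : ∀ c : ℝ, 3 / 2 ≤ c → c ≤ 7 / 4 → ∀ u : E, SuppE c u → SuppF c (φ u))
    (hψ : ∀ c : ℝ, 3 / 2 ≤ c → c ≤ 7 / 4 → ∀ u : E, ∀ f : F, SuppF c f → SuppE c (ψ u f))
    (hS : ∀ k : ℕ, ∀ c : ℝ, ∀ x : E, SuppE c x → SuppE (c - η k) (S (SaintRaymond.theta θ₀ k) x))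
    (h0 : SuppE (7 / 4) u₀) (k : ℕ) :
    SuppE (3 / 2) (SaintRaymond.seq S φ ψ u₀ θ₀ k) := by
  have h := supported_seq S φ ψ u₀ θ₀ SuppE SuppF (3 / 2) (7 / 4) η hη anti add neg hφ hψ hS h0 k
    (by linarith [hsum k])
  exact anti _ _ (by linarith [hsum k]) _ h

end Support

end Hintz2026.NashMoserInterface

end Literature.Geometry.Lorentzian
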